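import Mathlib
import Summits.MatrixMultiplication.MatrixMultiplication.Theses.FidelityWitnesses
import Summits.MatrixMultiplication.MatrixMultiplication.Theorems.FidelityWitnessesFidelityGapTwoSixConeClosure
import Summits.MatrixMultiplication.MatrixMultiplication.Theorems.FidelityWitnessesFidelityGapTwoSixRankConeSmul
import Literature.Computability.AlgebraicComplexity.BorderRankMatMulTwoHolds

/-!
# `FidelityWitnesses.FidelityGapTwoSix` (stmt-MatrixMultiplication-4957) — proved, line `closure-transfer`

The crux `∃ ε > 0, ∀ S (tensorRank S ≤ 6), ‖Σ S·⟨2,2,2⟩‖² ≤ (1 − ε)·8·Σ‖S‖²` of route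
`MatrixMultiplication/FidelityWitnesses` is the METRIC SHADOW of a tree theorem:
`⟨2,2,2⟩ ∉ closure {S | tensorRank S ≤ 6}` (`fidelityGapTwoSix_notMem_closure_six` below, from
`Landsberg2005_borderRank_matMulTensor_two_holds` — torus-fixed border apolarity, `7 ≤ R̲(⟨2,2,2⟩)` —
read through `Landsberg2005_borderRank_matMulTensor_two_iff_notMem_closure` and Alder's theorem
`alder_secantVariety_eq_setOf_algBorderRank_le_holds`, all sorry-free in `Literature`).  The transfer
from "not a limit" to "uniform fidelity gap" is the closure criterion for a complex cone
(`stub_coneClosure`, file `FidelityWitnessesFidelityGapTwoSixConeClosure`: near-optimal sesquilinear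
overlaps inside a ℂ-cone put `T` in its closure, by projecting `T` onto the line through a near-optimal
`S`) applied to the cone `{S | tensorRank S ≤ 6}` (`stub_rankConeSmul`, file
`FidelityWitnessesFidelityGapTwoSixRankConeSmul`).  The glue below supplies `Σ‖⟨2,2,2⟩_abc‖² = 8` and
the equality of the bilinear and sesquilinear overlaps with the REAL tensor `⟨2,2,2⟩`.

This is the skeleton `Cruxes/FidelityGapTwoSix/Lines/closure-transfer.lean` (crux-plan round 1, line
lead `prover-line-stmt-MatrixMultiplication-4957-lean-0`) with both registered stubs landed.  The proof
is ineffective in `ε` (any witness must have `ε ≤ 1/8`: `⟨2,2,2⟩` minus one standard triad has rank `6`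
and fidelity `7/8`).
-/

namespace Summit.MatrixMultiplication.MatrixMultiplication.Theorems

open scoped BigOperators ComplexConjugate
open Literature.Computability.AlgebraicComplexity

/-- **The transferred input, a theorem of the tree**: `⟨2,2,2⟩` is not a limit of tensors of rank
`≤ 6` (`7 ≤ R̲(⟨2,2,2⟩)`, `Landsberg2005_borderRank_matMulTensor_two_holds`; Alder's theorem
`alder_secantVariety_eq_setOf_algBorderRank_le_holds`; Zariski = Euclidean closure of the rank locus
over `ℂ`, inside `…_iff_notMem_closure`). [folklore] -/
theorem fidelityGapTwoSix_notMem_closure_six :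
    matMulTensor ℂ 2 2 2 ∉ closure
      {s : (Fin 2 × Fin 2) → (Fin 2 × Fin 2) → (Fin 2 × Fin 2) → ℂ | tensorRank s ≤ 6} :=
  (Landsberg2005_borderRank_matMulTensor_two_iff_notMem_closure
      alder_secantVariety_eq_setOf_algBorderRank_le_holds).1
    Landsberg2005_borderRank_matMulTensor_two_holds

/-- The entries of `⟨2,2,2⟩` are real (`0/1`), so complex conjugation fixes them. [folklore] -/
theorem fidelityGapTwoSix_conj_matMulTensor_two (a b c : Fin 2 × Fin 2) :
    (starRingEnd ℂ) (matMulTensor ℂ 2 2 2 a b c) = matMulTensor ℂ 2 2 2 a b c := by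
  unfold matMulTensor
  split_ifs <;> simp

/-- Sesquilinear and bilinear overlaps with the real tensor `⟨2,2,2⟩` have the same norm.
[folklore] -/
theorem fidelityGapTwoSix_norm_overlap_conj
    (S : (Fin 2 × Fin 2) → (Fin 2 × Fin 2) → (Fin 2 × Fin 2) → ℂ) :
    ‖∑ a, ∑ b, ∑ c, (starRingEnd ℂ) (S a b c) * matMulTensor ℂ 2 2 2 a b c‖ =
      ‖∑ a, ∑ b, ∑ c, S a b c * matMulTensor ℂ 2 2 2 a b c‖ := by
  have h : (∑ a, ∑ b, ∑ c, (starRingEnd ℂ) (S a b c) * matMulTensor ℂ 2 2 2 a b c)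
      = (starRingEnd ℂ) (∑ a, ∑ b, ∑ c, S a b c * matMulTensor ℂ 2 2 2 a b c) := by
    simp only [map_sum, map_mul, fidelityGapTwoSix_conj_matMulTensor_two]
  rw [h, Complex.norm_conj]

/-- `‖⟨2,2,2⟩‖² = 8`: the tensor has exactly `2³` entries equal to `1`, all others `0`.
[folklore] -/
theorem fidelityGapTwoSix_normSq_matMulTensor_two :
    (∑ a : Fin 2 × Fin 2, ∑ b : Fin 2 × Fin 2, ∑ c : Fin 2 × Fin 2,
      ‖matMulTensor ℂ 2 2 2 a b c‖ ^ 2) = (8 : ℝ) := by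
  have hNN : ∀ a b c : Fin 2 × Fin 2,
      ‖matMulTensor ℂ 2 2 2 a b c‖ ^ 2 = matMulTensor ℝ 2 2 2 a b c := by
    intro a b c
    simp only [matMulTensor]
    split_ifs <;> simp
  simp_rw [hNN]
  have h1 : ∀ a b : Fin 2 × Fin 2,
      (∑ c : Fin 2 × Fin 2, matMulTensor ℝ 2 2 2 a b c) = if a.1 = b.1 then 1 else 0 := by
    intro a b
    by_cases hab : a.1 = b.1
    · rw [if_pos hab, Finset.sum_eq_single (b.2, a.2)]
      · simp [matMulTensor, hab]
      · intro c _ hc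
        simp only [matMulTensor]
        rw [if_neg]
        rintro ⟨-, h2, h3⟩
        exact hc (Prod.ext h2.symm h3.symm)
      · intro h
        exact absurd (Finset.mem_univ _) h
    · rw [if_neg hab]
      exact Finset.sum_eq_zero fun c _ => by
        simp [matMulTensor, hab]
  have h2 : ∀ a : Fin 2 × Fin 2, (∑ b : Fin 2 × Fin 2, if a.1 = b.1 then (1 : ℝ) else 0) = 2 := by
    intro a
    rw [Fintype.sum_prod_type, Finset.sum_comm]
    simp
  simp_rw [h1, h2]
  simp [Finset.sum_const, Finset.card_univ, Fintype.card_prod, Fintype.card_fin]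
  norm_num

/-- **`FidelityGapTwoSix` (crux `stmt-MatrixMultiplication-4957` of route
`MatrixMultiplication/FidelityWitnesses`), proved along line `closure-transfer`.**  Six (border)
multiplications cannot be perfectly correlated with `2 × 2` matrix multiplication: some `ε > 0` has
`‖Σ S·⟨2,2,2⟩‖² ≤ (1 − ε)·8·Σ‖S‖²` for every `S` of tensor rank `≤ 6`.  Were there no gap, for every
`ε > 0` some rank-`≤ 6` tensor `S` would have `‖Σ S·⟨2,2,2⟩‖² > (1 − ε)·8·Σ‖S‖² =
(1 − ε)·Σ‖S‖²·Σ‖⟨2,2,2⟩‖²`, the same for the sesquilinear overlap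
(`fidelityGapTwoSix_norm_overlap_conj`), so by the closure criterion `stub_coneClosure` applied to the
cone `{S | R(S) ≤ 6}` (`stub_rankConeSmul`) the tensor `⟨2,2,2⟩` would be a limit of rank-`≤ 6`
tensors, contradicting `fidelityGapTwoSix_notMem_closure_six` (`7 ≤ R̲(⟨2,2,2⟩)`, Landsberg 2005, a
tree theorem). [folklore] -/
theorem fidelityGapTwoSix_proof :
    Summit.MatrixMultiplication.MatrixMultiplication.Theses.FidelityWitnesses.FidelityGapTwoSix := by
  unfold Summit.MatrixMultiplication.MatrixMultiplication.Theses.FidelityWitnesses.FidelityGapTwoSix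
  by_contra hgap
  refine fidelityGapTwoSix_notMem_closure_six
    (stub_coneClosure _ (fun c S hS => ?_) _ fun ε hε => ?_)
  · show tensorRank (c • S) ≤ 6
    exact (stub_rankConeSmul c S).trans hS
  · push Not at hgap
    obtain ⟨S, hS, hlt⟩ := hgap ε hε
    refine ⟨S, hS, ?_⟩
    rw [fidelityGapTwoSix_norm_overlap_conj, fidelityGapTwoSix_normSq_matMulTensor_two]
    have hcomm : (1 - ε) * (∑ a, ∑ b, ∑ c, ‖S a b c‖ ^ 2) * 8
        = (1 - ε) * 8 * ∑ a, ∑ b, ∑ c, ‖S a b c‖ ^ 2 := by ring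
    rw [hcomm]
    exact hlt

end Summit.MatrixMultiplication.MatrixMultiplication.Theorems
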